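import Mathlib
import HarnessLib

/-!
# BalabanIR engine `BirComplexStableXYR` (stmt-HubbardSuperconductivity-14845), line
# `fat_gaussian_defect_calculus`, chapter T-end: the Neumann resolvent bound

Generic (project-definition-free) piece of the elementary dominant-eigenvalue analysis of the effective
1-D transfer operator on a complex Banach space `E`.  Everything lives in the complete normed ring
`E →L[ℂ] E` of bounded operators (`*` = composition, `1` = identity, `Ring.inverse` for inverses of units).

`stub_resolventBound`: if `‖M‖ ≤ θ < ‖μ‖` then `μ • 1 - M` is a unit of `E →L[ℂ] E` and
`‖Ring.inverse (μ • 1 - M)‖ ≤ 1 / (‖μ‖ - θ)`.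

Proof (Neumann series): `μ ≠ 0`; with `s := μ⁻¹ • M` one has `‖s‖ ≤ θ / ‖μ‖ < 1` and
`μ • 1 - M = μ • (1 - s)`.  The geometric series `T := ∑' n, s ^ n` is a two-sided inverse of `1 - s`
(`mul_neg_geom_series`, `geom_series_mul_neg`), so `μ⁻¹ • T` is a two-sided inverse of `μ • 1 - M`; this
gives the unit and `Ring.inverse (μ • 1 - M) = μ⁻¹ • T` (`Ring.inverse_unit`).  Finally
`‖T‖ ≤ ‖1‖ - 1 + (1 - ‖s‖)⁻¹ ≤ (1 - θ/‖μ‖)⁻¹` (`tsum_geometric_le_of_norm_lt_one`, `‖1‖ ≤ 1` for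
operators), whence `‖μ⁻¹ • T‖ ≤ ‖μ‖⁻¹ (1 - θ/‖μ‖)⁻¹ = 1 / (‖μ‖ - θ)`. [folklore]
-/

set_option linter.dupNamespace false -- summit = problem name (single-conjunct summit), D-0017

namespace Summit.HubbardSuperconductivity.HubbardSuperconductivity.Theorems.TEnd

open scoped ComplexConjugate

/-- Neumann resolvent bound.  For a bounded operator `M` on a complex Banach space `E` with `‖M‖ ≤ θ`
and a scalar `μ` with `θ < ‖μ‖`, the operator `μ • 1 - M` is a unit of the ring `E →L[ℂ] E` and its
inverse satisfies `‖Ring.inverse (μ • 1 - M)‖ ≤ 1 / (‖μ‖ - θ)` (geometric series in `μ⁻¹ • M`).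
[folklore] -/
theorem stub_resolventBound :
    ∀ (E : Type) [NormedAddCommGroup E] [NormedSpace ℂ E] [CompleteSpace E]
      (M : E →L[ℂ] E) (θ : ℝ), ‖M‖ ≤ θ → ∀ (μ : ℂ), θ < ‖μ‖ →
        IsUnit (μ • (1 : E →L[ℂ] E) - M) ∧ ‖Ring.inverse (μ • (1 : E →L[ℂ] E) - M)‖ ≤ 1 / (‖μ‖ - θ) := by
  intro E _ _ _ M θ hM μ hμ
  have hθ0 : 0 ≤ θ := (norm_nonneg M).trans hM
  have hμpos : 0 < ‖μ‖ := hθ0.trans_lt hμ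
  have hμne : μ ≠ 0 := norm_pos_iff.mp hμpos
  -- The small operator `s := μ⁻¹ • M`, `‖s‖ ≤ θ / ‖μ‖ < 1`.
  set s : E →L[ℂ] E := μ⁻¹ • M with hs_def
  have hs_norm : ‖s‖ ≤ θ / ‖μ‖ := by
    rw [hs_def, norm_smul, norm_inv, div_eq_inv_mul]
    exact mul_le_mul_of_nonneg_left hM (inv_nonneg.mpr hμpos.le)
  have hθμ : θ / ‖μ‖ < 1 := (div_lt_one hμpos).mpr hμ
  have hs1 : ‖s‖ < 1 := hs_norm.trans_lt hθμ
  -- `μ • 1 - M = μ • (1 - s)`.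
  have hkey : μ • (1 : E →L[ℂ] E) - M = μ • (1 - s) := by
    rw [hs_def, smul_sub, smul_smul, mul_inv_cancel₀ hμne, one_smul]
  -- The geometric series `T := ∑' n, s ^ n` inverts `1 - s` on both sides.
  set T : E →L[ℂ] E := ∑' n : ℕ, s ^ n with hT_def
  have hT1 : (1 - s) * T = 1 := mul_neg_geom_series s hs1
  have hT2 : T * (1 - s) = 1 := geom_series_mul_neg s hs1
  -- Hence `μ⁻¹ • T` is a two-sided inverse of `μ • 1 - M`: build the unit.
  let u : (E →L[ℂ] E)ˣ :=
    { val := μ • (1 : E →L[ℂ] E) - M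
      inv := μ⁻¹ • T
      val_inv := by
        rw [hkey, smul_mul_smul_comm, mul_inv_cancel₀ hμne, hT1, one_smul]
      inv_val := by
        rw [hkey, smul_mul_smul_comm, inv_mul_cancel₀ hμne, hT2, one_smul] }
  have hunit : IsUnit (μ • (1 : E →L[ℂ] E) - M) := ⟨u, rfl⟩
  have hinv : Ring.inverse (μ • (1 : E →L[ℂ] E) - M) = μ⁻¹ • T := Ring.inverse_unit u
  refine ⟨hunit, ?_⟩
  -- Norm bound on the geometric series (no `‖1‖ = 1` needed: `‖1‖ ≤ 1` for operators).
  have hTnorm : ‖T‖ ≤ (1 - ‖s‖)⁻¹ := by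
    have h1 : ‖T‖ ≤ ‖(1 : E →L[ℂ] E)‖ - 1 + (1 - ‖s‖)⁻¹ := tsum_geometric_le_of_norm_lt_one s hs1
    have h2 : ‖(1 : E →L[ℂ] E)‖ ≤ 1 := ContinuousLinearMap.norm_id_le
    linarith
  have hden : 0 < ‖μ‖ - θ := sub_pos.mpr hμ
  have h1θ : 0 < 1 - θ / ‖μ‖ := sub_pos.mpr hθμ
  rw [hinv, norm_smul, norm_inv]
  calc ‖μ‖⁻¹ * ‖T‖ ≤ ‖μ‖⁻¹ * (1 - θ / ‖μ‖)⁻¹ := by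
        refine mul_le_mul_of_nonneg_left (hTnorm.trans ?_) (inv_nonneg.mpr hμpos.le)
        exact inv_anti₀ h1θ (by linarith)
    _ = 1 / (‖μ‖ - θ) := by
        rw [← mul_inv, mul_sub, mul_one, mul_div_cancel₀ θ hμpos.ne', one_div]

end Summit.HubbardSuperconductivity.HubbardSuperconductivity.Theorems.TEnd
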